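import Summits.Schanuel.Schanuel.Theorems.RootDecomp1KGeneric02
import Mathlib.NumberTheory.Padics.PadicVal.Basic
import Literature.NumberTheory.Transcendental.OneMotiveToric

/-!
# HyperStoreyDescent — writer-1 g11 kernel note for the critic's ruling on lens-6 REQUEST L1226 (3)

LEVEL DESCENT for the cut predicate A₄ʰ: the Schanuel bound for ℚ-free hyper-Liouville
`(n+1)`-tuples implies it for ℚ-free hyper-Liouville `n`-tuples (pad `z` with `w = log p`,
`p` a prime with `log p ∉ span_ℚ(z)`: the cut predicate survives padding by a zero coefficient,
`(z, w)` stays ℚ-free, and `trdeg` grows by at most one because `e^w = p ∈ ℚ`).  Consequently the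
storey `HyperStoreyFrom4` (levels `n ≥ 4`) of the GENERIC CELLS assembly is EQUIVALENT to the live
crux `Theses.RootDecomp1K.HyperLiouvilleSchanuel` (stmt-Schanuel-33363) — unconditionally, no
transcendence input — and the binders `hKS hCF hR` of `hyperLiouvilleSchanuel_live_of_pieces` are
not load-bearing for that implication.  Scratch certificate (writer folder), not a tree file.
-/


noncomputable section

open Complex IntermediateField

namespace Summit.Schanuel.Schanuel.Theorems.RootDecomp1KGeneric

open Summit.Schanuel.Schanuel.Theorems.RootDecomp1KHyper (SB SFset)
open Summit.Schanuel.Schanuel.Theorems.RootDecomp1KHyper.HyperCell (HyperLinLiouville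
  hyperLinLiouville_of_prefix hyperLiouvilleSchanuel_iff_live)
/-- `padicValRat` of a finite product of non-zero rationals (copy of the tree lemma in
`…AclSubsetLogFreeCore.Negative.StandardKernelTwistLinear`, whose import cone is unbuilt on the farm tonight). -/
private theorem padicValRat_prod' {p : ℕ} [Fact p.Prime] {ι : Type*} (s : Finset ι) (f : ι → ℚ)
    (hf : ∀ i ∈ s, f i ≠ 0) : padicValRat p (∏ i ∈ s, f i) = ∑ i ∈ s, padicValRat p (f i) := by
  classical
  induction s using Finset.induction_on with
  | empty => simp
  | insert a s ha ih =>
    rw [Finset.prod_insert ha, Finset.sum_insert ha,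
      padicValRat.mul (hf a (Finset.mem_insert_self a s))
        (Finset.prod_ne_zero_iff.2 fun i hi => hf i (Finset.mem_insert_of_mem hi)),
      ih fun i hi => hf i (Finset.mem_insert_of_mem hi)]

/-- The logarithms of the primes are `ℚ`-linearly independent (unique factorisation; copy of the tree's
`…AclSubsetLogFreeCore.Negative.StandardKernelTwistLinear.linearIndependent_log_primes`). -/
private theorem linearIndependent_log_primes' :
    LinearIndependent ℚ (fun p : Nat.Primes => ((Real.log (p : ℕ) : ℝ) : ℂ)) := by
  rw [← LinearIndependent.iff_fractionRing ℤ ℚ, linearIndependent_iff']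
  intro s g hsum p hp
  have hR : ∑ i ∈ s, (g i : ℝ) * Real.log (i : ℕ) = 0 := by
    apply Complex.ofReal_injective
    push_cast
    simpa [zsmul_eq_mul] using hsum
  have hne : ∀ i ∈ s, (((i : Nat.Primes) : ℕ) : ℝ) ^ (g i) ≠ 0 := fun i _ =>
    zpow_ne_zero _ (by exact_mod_cast i.2.ne_zero)
  have hprod : Real.log (∏ i ∈ s, (((i : ℕ) : ℝ)) ^ (g i)) = 0 := by
    rw [Real.log_prod hne]
    simpa [Real.log_zpow] using hR
  have hpos : 0 < ∏ i ∈ s, (((i : ℕ) : ℝ)) ^ (g i) :=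
    Finset.prod_pos fun i _ => zpow_pos (by exact_mod_cast i.2.pos) _
  have hone : ∏ i ∈ s, (((i : ℕ) : ℝ)) ^ (g i) = 1 := by
    rcases Real.log_eq_zero.1 hprod with h | h | h
    · exact absurd h hpos.ne'
    · exact h
    · linarith
  have hQ : ∏ i ∈ s, (((i : ℕ) : ℚ)) ^ (g i) = 1 := by
    have : ((∏ i ∈ s, (((i : ℕ) : ℚ)) ^ (g i) : ℚ) : ℝ) = 1 := by push_cast; exact hone
    exact_mod_cast this
  haveI : Fact (p : ℕ).Prime := ⟨p.2⟩
  have hval := congrArg (padicValRat (p : ℕ)) hQ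
  rw [padicValRat_prod' _ _ (fun i _ => zpow_ne_zero _ (by exact_mod_cast i.2.ne_zero)),
    padicValRat.one] at hval
  simp only [padicValRat.zpow] at hval
  rw [Finset.sum_eq_single p] at hval
  · simpa [padicValRat.self p.2.one_lt] using hval
  · intro i _ hip
    haveI : Fact (i : ℕ).Prime := ⟨i.2⟩
    have hne' : (p : ℕ) ≠ (i : ℕ) := fun h => hip (Subtype.ext h).symm
    have : padicValRat (p : ℕ) ((i : ℕ) : ℚ) = 0 := by
      rw [← padicValRat_of_nat, padicValNat_primes hne']; simp
    simp [this]
  · intro h; exact absurd hp h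

/-- Some prime `p` has `log p ∉ span_ℚ(z)` (the logarithms of the primes are ℚ-linearly
independent and `span_ℚ(z)` is finite-dimensional). -/
theorem exists_prime_log_not_mem_span {n : ℕ} (z : Fin n → ℂ) :
    ∃ p : Nat.Primes, ((Real.log (p : ℕ) : ℝ) : ℂ) ∉ Submodule.span ℚ (Set.range z) := by
  by_contra hall
  push Not at hall
  set V : Submodule ℚ ℂ := Submodule.span ℚ (Set.range z) with hV
  -- `n + 1` distinct primes
  let f : Fin (n + 1) → Nat.Primes := fun i => ⟨Nat.nth Nat.Prime i, Nat.prime_nth_prime i⟩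
  have hf : Function.Injective f := by
    intro i j hij
    have h1 : Nat.nth Nat.Prime i = Nat.nth Nat.Prime j := congrArg (fun q : Nat.Primes => (q : ℕ)) hij
    exact Fin.ext (Nat.nth_injective Nat.infinite_setOf_prime h1)
  have hli : LinearIndependent ℚ (fun i : Fin (n + 1) => ((Real.log (f i : ℕ) : ℝ) : ℂ)) :=
    linearIndependent_log_primes'.comp f hf
  -- the same family, valued in `V`
  let g : Fin (n + 1) → V := fun i => ⟨((Real.log (f i : ℕ) : ℝ) : ℂ), hall (f i)⟩
  have hg : LinearIndependent ℚ g := by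
    refine LinearIndependent.of_comp V.subtype ?_
    exact hli
  haveI : Module.Finite ℚ V := FiniteDimensional.span_of_finite ℚ (Set.finite_range z)
  have h1 := hg.fintype_card_le_finrank
  rw [Fintype.card_fin] at h1
  have h2 : Module.finrank ℚ V ≤ n := by
    have := finrank_range_le_card (R := ℚ) z
    simpa [Set.finrank] using this
  omega

/-- Padding a tuple by one coordinate keeps the cut predicate (zero coefficient on the new
coordinate; tree `hyperLinLiouville_of_prefix`). -/
theorem hyperLinLiouville_snoc {n : ℕ} {z : Fin n → ℂ} (hH : HyperLinLiouville z) (w : ℂ) :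
    HyperLinLiouville (Fin.snoc z w : Fin (n + 1) → ℂ) := by
  refine hyperLinLiouville_of_prefix (Nat.le_succ n) ?_
  have hfun : (fun i : Fin n => (Fin.snoc z w : Fin (n + 1) → ℂ) (Fin.castLE (Nat.le_succ n) i)) = z := by
    funext i
    have hi : Fin.castLE (Nat.le_succ n) i = Fin.castSucc i := Fin.ext rfl
    rw [hi, Fin.snoc_castSucc]
  rw [hfun]
  exact hH

/-- The Schanuel field of the padded tuple `(z, log p)` sits inside `ℚ(SFset z)(p)(log p)`. -/
theorem sfset_snoc_subset {n : ℕ} (z : Fin n → ℂ) (w : ℂ) :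
    SFset (Fin.snoc z w : Fin (n + 1) → ℂ) ⊆ insert w (insert (cexp w) (SFset z)) := by
  rintro x (⟨i, rfl⟩ | ⟨i, rfl⟩)
  · refine Fin.lastCases ?_ (fun j => ?_) i
    · exact Or.inl (by simp)
    · exact Or.inr (Or.inr (Or.inl ⟨j, by simp⟩))
  · refine Fin.lastCases ?_ (fun j => ?_) i
    · exact Or.inr (Or.inl (by simp))
    · exact Or.inr (Or.inr (Or.inr ⟨j, by simp⟩))

/-- `trdeg` is monotone along inclusions of intermediate fields. -/
private theorem trdeg_mono' {L L' : IntermediateField ℚ ℂ} (h : L ≤ L') :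
    Algebra.trdeg ℚ L ≤ Algebra.trdeg ℚ L' :=
  trdeg_le_of_injective (IntermediateField.inclusion h) (IntermediateField.inclusion_injective h)

/-- Padding by `w = log p` raises `trdeg ℚ(z, e^z)` by at most one (`e^w = p` is rational). -/
theorem trdeg_sfset_snoc_log_prime_le {n : ℕ} (z : Fin n → ℂ) (p : Nat.Primes) :
    Algebra.trdeg ℚ ↥(adjoin ℚ (SFset (Fin.snoc z ((Real.log (p : ℕ) : ℝ) : ℂ) : Fin (n + 1) → ℂ))) ≤
      Algebra.trdeg ℚ ↥(adjoin ℚ (SFset z)) + 1 := by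
  set w : ℂ := ((Real.log (p : ℕ) : ℝ) : ℂ) with hw
  have hexp : cexp w = ((p : ℕ) : ℂ) := by
    rw [hw, ← Complex.ofReal_exp, Real.exp_log (by exact_mod_cast p.2.pos)]
    push_cast
    rfl
  -- adjoining the rational number `p` changes nothing
  have hp_mem : ((p : ℕ) : ℂ) ∈ adjoin ℚ (SFset z) := _root_.natCast_mem _ _
  have hins : adjoin ℚ (insert (cexp w) (SFset z)) = adjoin ℚ (SFset z) := by
    refine le_antisymm ?_ (adjoin.mono ℚ _ _ (Set.subset_insert _ _))
    rw [adjoin_le_iff]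
    rintro x (rfl | hx)
    · rw [hexp]; exact hp_mem
    · exact subset_adjoin ℚ _ hx
  calc Algebra.trdeg ℚ ↥(adjoin ℚ (SFset (Fin.snoc z w : Fin (n + 1) → ℂ)))
      ≤ Algebra.trdeg ℚ ↥(adjoin ℚ (insert w (insert (cexp w) (SFset z)))) :=
        trdeg_mono' (adjoin.mono ℚ _ _ (sfset_snoc_subset z w))
    _ ≤ Algebra.trdeg ℚ ↥(adjoin ℚ (insert (cexp w) (SFset z))) + 1 :=
        Literature.NumberTheory.Transcendental.trdeg_adjoin_insert_le _ w
    _ = Algebra.trdeg ℚ ↥(adjoin ℚ (SFset z)) + 1 := by rw [hins]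

/-- **LEVEL DESCENT for A₄ʰ**: the Schanuel bound on all ℚ-free hyper-Liouville `(n+1)`-tuples
implies it on all ℚ-free hyper-Liouville `n`-tuples. -/
theorem sb_descent {n : ℕ}
    (hup : ∀ z : Fin (n + 1) → ℂ, LinearIndependent ℚ z → HyperLinLiouville z → SB (n + 1) z)
    (z : Fin n → ℂ) (hz : LinearIndependent ℚ z) (hH : HyperLinLiouville z) : SB n z := by
  obtain ⟨p, hp⟩ := exists_prime_log_not_mem_span z
  set w : ℂ := ((Real.log (p : ℕ) : ℝ) : ℂ) with hw
  have hz' : LinearIndependent ℚ (Fin.snoc z w : Fin (n + 1) → ℂ) := linearIndependent_finSnoc.2 ⟨hz, hp⟩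
  have hSB := hup _ hz' (hyperLinLiouville_snoc hH w)
  have hle := trdeg_sfset_snoc_log_prime_le z p
  -- (n + 1 : Cardinal) ≤ trdeg(z', e^{z'}) ≤ trdeg(z, e^z) + 1
  have h : ((n + 1 : ℕ) : Cardinal) ≤ Algebra.trdeg ℚ ↥(adjoin ℚ (SFset z)) + 1 := hSB.trans hle
  rw [Nat.cast_add, Nat.cast_one] at h
  exact Cardinal.add_one_le_add_one_iff.mp h

/-- Descent through any number of levels. -/
theorem sb_descent_le {N n : ℕ} (hnN : n ≤ N)
    (hup : ∀ z : Fin N → ℂ, LinearIndependent ℚ z → HyperLinLiouville z → SB N z)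
    (z : Fin n → ℂ) (hz : LinearIndependent ℚ z) (hH : HyperLinLiouville z) : SB n z := by
  induction N, hnN using Nat.le_induction generalizing z with
  | base => exact hup z hz hH
  | succ N hnN ih => exact ih (fun y hy hyH => sb_descent hup y hy hyH) z hz hH

/-- **The storey `n ≥ 4` IS the crux**: `HyperStoreyFrom4 ↔ Theses.RootDecomp1K.HyperLiouvilleSchanuel`
(stmt-Schanuel-33363), unconditionally. -/
theorem hyperStoreyFrom4_iff_live :
    HyperStoreyFrom4 ↔ Summit.Schanuel.Schanuel.Theses.RootDecomp1K.HyperLiouvilleSchanuel := by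
  rw [← hyperLiouvilleSchanuel_iff_live]
  constructor
  · intro h4 n z hz hH
    rcases le_or_gt 4 n with hn | hn
    · exact h4 n z hn hz hH
    · exact sb_descent_le (N := 4) hn.le (fun y hy hyH => h4 4 y le_rfl hy hyH) z hz hH
  · intro h n z _ hz hH
    exact h n z hz hH

/-- In particular `HyperStoreyFrom4` alone gives `Rank3HyperResidual` and the whole level 3. -/
theorem level3_of_hyperStoreyFrom4 (h4 : HyperStoreyFrom4) (z : Fin 3 → ℂ)
    (hz : LinearIndependent ℚ z) (hH : HyperLinLiouville z) : SB 3 z :=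
  sb_descent (fun y hy hyH => h4 4 y le_rfl hy hyH) z hz hH

/-- `HyperStoreyFrom4` alone gives `Rank3HyperResidual` (level descent to level 3). -/
theorem rank3HyperResidual_of_hyperStoreyFrom4 (h4 : HyperStoreyFrom4) : Rank3HyperResidual :=
  fun z hz hH _ => level3_of_hyperStoreyFrom4 h4 z hz hH

/-- The GENERIC CELLS assembly with its three other binders dropped. -/
theorem hyperLiouvilleSchanuel_live_of_hyperStoreyFrom4 (h4 : HyperStoreyFrom4) :
    Summit.Schanuel.Schanuel.Theses.RootDecomp1K.HyperLiouvilleSchanuel :=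
  hyperStoreyFrom4_iff_live.mp h4

end Summit.Schanuel.Schanuel.Theorems.RootDecomp1KGeneric
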